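import Literature.Topology.FourManifolds.HCobordismWhitneyTrickProofs
import Literature.Topology.FourManifolds.HCobordismComplementRightSphere
import Literature.Topology.FourManifolds.HCobordismIntersectionNumberSlabProofs
import HarnessLib

/-!
# Milnor 1965, Thm. 6.4 / Cor. 6.5 on a slab: the current leaves — Cor. 7.3 on the slab and
# the Whitney procedure Thm. 6.6

Topic `Literature/Topology/FourManifolds` (fact seat
`provefact-Literature.Topology.FourManifolds.Cobordism.Milnor1965_secondCancellation_slab`).
The named fact `Literature.Topology.FourManifolds.Cobordism.Milnor1965_secondCancellation_slab`
of `HCobordismMiddleStep.lean` (the Second Cancellation Theorem 6.4 with Cor. 6.5, second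
sentence, applied to the sub-triad `c_p c_{p'} = f⁻¹[a₀, a₁]`; Milnor, *Lectures on the
h-cobordism theorem* (1965), PDF pp. 37–39 of the held copy
`lit read book:milnornd-lectures-h-cobordism-theorem`) has been reduced, along the printed
proof of PDF p. 39, as follows:

* `HCobordismSecondCancellation.lean`, `HCobordismTransversePosition.lean`,
  `HCobordismTransverseSpheres.lean`: Thm. 5.2 (Lemma 5.3 by Sard's theorem and the isotopy of
  Lemma 4.6, with the product neighbourhoods of Def. 3.9), Lemma 4.7 and the induction on the
  number of intersection points are theorems; the fact follows from the single leaf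
  `Literature.Topology.FourManifolds.Cobordism.Milnor1965_whitneyTrick_isotopy` (one round of
  the Whitney procedure on the level),
  `Literature.Topology.FourManifolds.Cobordism.Milnor1965_secondCancellation_slab_of_whitney`;
* `HCobordismWhitneyTrick.lean`, `HCobordismWhitneyTrickProofs.lean`,
  `HCobordismComplementRightSphere.lean`: that leaf follows from Cor. 7.3 on the slab
  (`Literature.Topology.FourManifolds.Cobordism.Milnor1965_intersectionNumber_slab`: the
  intersection number `S_R · S_L' = ±1`, Def. 6.1, from `H⁎(c_p c_{p'}, V₀; ℤ) = 0`), Thm. 6.6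
  with its Remark (`Literature.Topology.FourManifolds.Milnor1965_whitney_isotopy`) and the
  case `λ = 2` of PDF p. 39, the last being a theorem
  (`Literature.Topology.FourManifolds.Cobordism.Milnor1965_simplyConnected_compl_rightHandSphere_holds`),
  as are Remark 1 after Thm. 6.4 and the two chart-bookkeeping passages between the printed
  forms of transversality.

This file only records the composite: **Thm. 6.4 / Cor. 6.5 on a slab from Cor. 7.3 on the
slab and Thm. 6.6** — the present trust base of the fact.

## References

* J. Milnor, *Lectures on the h-cobordism theorem*, notes by L. Siebenmann and J. Sondow,
  Princeton Mathematical Notes (1965): Thm. 6.4, Remarks, Cor. 6.5, Thm. 6.6 and Remark,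
  proof of Thm. 6.4 (PDF pp. 37–39), Cor. 7.3 (PDF p. 47).  Held:
  `lit read book:milnornd-lectures-h-cobordism-theorem`. [MilnorHCobordism1965]
-/

noncomputable section

namespace Literature.Topology.FourManifolds

universe u

/-- **Milnor 1965, Thm. 6.4 / Cor. 6.5 on a slab
(`Literature.Topology.FourManifolds.Cobordism.Milnor1965_secondCancellation_slab`) from its two
remaining printed ingredients: Cor. 7.3 on the slab (`S_R · S_L' = ±1` from the vanishing of
`H⁎(c_p c_{p'}, V₀; ℤ)`) and the Whitney procedure Thm. 6.6 with its Remark.**  Everything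
else in the proof of PDF p. 39 — Thm. 5.2 (Lemma 5.3, Lemma 4.7), Remark 1 after Thm. 6.4,
the case `λ = 2`, the turning about of Cor. 6.5, the inversion of the isotopy and the
induction on the number of intersection points — is a theorem of the tree:
`Literature.Topology.FourManifolds.Cobordism.Milnor1965_secondCancellation_slab_of_whitney`
composed with
`Literature.Topology.FourManifolds.Cobordism.Milnor1965_whitneyTrick_isotopy_of_parts'` and
`Literature.Topology.FourManifolds.Cobordism.Milnor1965_simplyConnected_compl_rightHandSphere_holds`.
[cite: MilnorHCobordism1965, proof of Thm. 6.4 (PDF p. 39), Cor. 6.5 (PDF p. 38), Thm. 6.6 and Remark (PDF pp. 38–39), Cor. 7.3 (PDF p. 47)] -/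
theorem Cobordism.Milnor1965_secondCancellation_slab_of_intersectionNumber_of_whitney
    (h73 : Cobordism.Milnor1965_intersectionNumber_slab.{u})
    (h66 : Milnor1965_whitney_isotopy.{u, 0, 0}) :
    Cobordism.Milnor1965_secondCancellation_slab.{u} :=
  Cobordism.Milnor1965_secondCancellation_slab_of_whitney
    (Cobordism.Milnor1965_whitneyTrick_isotopy_of_parts' h73 h66
      Cobordism.Milnor1965_simplyConnected_compl_rightHandSphere_holds)

/-! ### After the discharge of Cor. 7.3 on the slab: the single remaining leaf is Thm. 6.6 -/

/-- **One round of the Whitney procedure on the level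
(`Literature.Topology.FourManifolds.Cobordism.Milnor1965_whitneyTrick_isotopy`) from Thm. 6.6
with its Remark alone.**  Cor. 7.3 on the slab (`S_R · S_L' = ±1`) is now a theorem of the
tree (`Literature.Topology.FourManifolds.Cobordism.Milnor1965_intersectionNumber_slab_holds`,
from Lemma 7.2 on the slab, `HCobordismIntersectionNumberSlabProofs.lean`), as is the case
`λ = 2` of PDF p. 39
(`Literature.Topology.FourManifolds.Cobordism.Milnor1965_simplyConnected_compl_rightHandSphere_holds`);
so the leaf of `HCobordismSecondCancellation.lean` rests on the Whitney procedure Thm. 6.6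
(`Literature.Topology.FourManifolds.Milnor1965_whitney_isotopy`) only.
[cite: MilnorHCobordism1965, proof of Thm. 6.4 (PDF p. 39), Thm. 6.6 and Remark (PDF pp. 38–39), Cor. 7.3 (PDF p. 47)] -/
theorem Cobordism.Milnor1965_whitneyTrick_isotopy_of_whitney_isotopy
    (h66 : Milnor1965_whitney_isotopy.{u, 0, 0}) :
    Cobordism.Milnor1965_whitneyTrick_isotopy.{u} :=
  Cobordism.Milnor1965_whitneyTrick_isotopy_of_parts''
    Cobordism.Milnor1965_intersectionNumber_slab_holds h66

/-- **Milnor 1965, Thm. 6.4 / Cor. 6.5 on a slab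
(`Literature.Topology.FourManifolds.Cobordism.Milnor1965_secondCancellation_slab`) from the
Whitney procedure Thm. 6.6 with its Remark alone** — the present trust base of the fact: every
other ingredient of the proof of PDF p. 39 (Thm. 5.2 with Lemma 5.3 and Lemma 4.7, Remark 1
after Thm. 6.4, Cor. 7.3 on the slab from Lemma 7.2, the case `λ = 2`, the turning about of
Cor. 6.5, the inversion of the isotopy, the induction on the number of intersection points) is
a theorem of the tree.
[cite: MilnorHCobordism1965, Thm. 6.4, Cor. 6.5 and the proof of Thm. 6.4 (PDF pp. 37–39), Thm. 6.6 and Remark (PDF pp. 38–39), Cor. 7.3 (PDF p. 47)] -/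
theorem Cobordism.Milnor1965_secondCancellation_slab_of_whitney_isotopy
    (h66 : Milnor1965_whitney_isotopy.{u, 0, 0}) :
    Cobordism.Milnor1965_secondCancellation_slab.{u} :=
  Cobordism.Milnor1965_secondCancellation_slab_of_intersectionNumber_of_whitney
    Cobordism.Milnor1965_intersectionNumber_slab_holds h66

end Literature.Topology.FourManifolds

end
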